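import Literature.NumberTheory.Transcendental.L2HodgeTheoryLaplacianProofs
import Literature.NumberTheory.Transcendental.L2HodgeTheoryExactCoexactProofs
import HarnessLib

/-!
# `⟪Δα, α⟫ = ‖δα‖² + ‖dα‖² ≥ 0` on a closed oriented Riemannian manifold (Warner 6.3 (1))

Topic: the real `L²` Hodge theory of `Literature/NumberTheory/Transcendental/L2HodgeTheory.lean`
(`MForm.l2Inner o α β = ∫_M ⟪α, β⟫ vol_o` and the named fact
`Literature.NumberTheory.Transcendental.l2Inner_hodgeLaplacian_self_nonneg`), continuing the
sibling proof files `L2HodgeTheoryExactCoexactProofs.lean` (Prop. 6.2 in `L²` form,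
`MForm.l2Inner_mextDeriv_left_of_isSmoothForm : ⟪dα, β⟫ = ⟪α, δβ⟫`) and
`L2HodgeTheoryLaplacianProofs.lean` (additivity `MForm.l2Inner_add_left_of_isSmoothForm`, the
polarised energy identity `l2Inner_hodgeLaplacian_left_eq : ⟪Δα, β⟫ = ⟪δα, δβ⟫ + ⟪dα, dβ⟫`, and
the symmetry of `Δ`, Warner's Corollary to Prop. 6.2). Source: F. W. Warner, *Foundations of
Differentiable Manifolds and Lie Groups*, GTM 94 (1983), Ch. 6, where "`M` will be a compact
oriented Riemannian manifold of dimension `n`" (p. 220; manifolds are Hausdorff, second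
countable and without boundary, Defs. 1.3–1.4; metrics are `C^∞`, 4.10):
`⟨α, β⟩ = ∫_M α ∧ *β` (6.1 (5), p. 220), Prop. 6.2 `⟨dα, β⟩ = ⟨α, δβ⟩` (pp. 220–221, by
Stokes), and the proof of Prop. 6.3, eq. (1), p. 221:
`⟨Δα, α⟩ = ⟨(dδ + δd)α, α⟩ = ⟨δα, δα⟩ + ⟨dα, dα⟩` — whence `⟨Δα, α⟩ ≥ 0`, the statement
vendored as `l2Inner_hodgeLaplacian_self_nonneg` (Jost, §3.3, Cor. 3.3.1).

## Main statements (all proved; no named fact is assumed)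

* `l2Inner_hodgeLaplacian_eq_of_degree_zero`, `l2Inner_hodgeLaplacian_eq_of_top_degree`: the
  energy identity in the two degenerate degree patterns of `hodgeLaplacian`
  (`Δ = δd` on functions, `Δ = dδ` in top degree): `⟪Δα, β⟫ = ⟪dα, dβ⟫`, resp. `= ⟪δα, δβ⟫`
  (the generic pattern is `l2Inner_hodgeLaplacian_left_eq` of the sibling file).
* `l2Inner_hodgeLaplacian_self_nonneg_of_isSmoothForm` — **`0 ≤ ⟪Δα, α⟫`** for a smooth `k`-form
  on a compact oriented Riemannian manifold without boundary (usable form, instances as section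
  hypotheses).
* `l2Inner_hodgeLaplacian_self_nonneg_of_compactSpace` — bridge: under the intended instances
  `[CompactSpace M] [I.Boundaryless] [IsContinuousRiemannianBundle E _]
  [IsContMDiffRiemannianBundle I ∞ E _]` the named fact `l2Inner_hodgeLaplacian_self_nonneg o` of
  `L2HodgeTheory.lean` holds *as declared*.
* `l2Inner_hodgeLaplacian_self_nonneg_of_isClosedManifold` — the **corrected, closed** named fact
  (all hypotheses bound inside the statement) and its discharge `…_of_isClosedManifold_holds`.

## Correction of `l2Inner_hodgeLaplacian_self_nonneg` (provefact pass, 2026-08-15)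

The named fact `Literature.NumberTheory.Transcendental.l2Inner_hodgeLaplacian_self_nonneg` is a
`def … : Prop` written inside `section Closed` of `L2HodgeTheory.lean`, after
`variable [CompactSpace M] [I.Boundaryless] [IsContinuousRiemannianBundle E _]
[IsContMDiffRiemannianBundle I ∞ E _]`. A `def` abstracts only the section variables its body
uses, so (checked by elaborating `@l2Inner_hodgeLaplacian_self_nonneg`) its statement binds
`[T2Space M] [SigmaCompactSpace M] [IsManifold I ∞ M] [RiemannianBundle _]` — what
`MForm.integral` and `hodgeLaplacian` need — but **not** compactness, **not** `I.Boundaryless`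
and no regularity of the metric. It therefore asserts `⟨Δα, α⟩ ≥ 0` on every Hausdorff
σ-compact `C^∞` manifold, with or without boundary, for fibre metrics of no regularity — not
Warner's setting (p. 220), and the printed proof (Stokes, 4.9 Corollary) does not apply. With
boundary the statement fails: on `M = [0, 1]` (flat metric, standard orientation, `vol = dx`
smooth) the `0`-form `α = eˣ` has `Δα = δdα = -α″ = -eˣ`, and
`⟨Δα, α⟩ = -∫₀¹ e^{2x} dx = -(e² - 1)/2 < 0` — the identity 6.3 (1) acquires the boundary term
`-[α α′]₀¹` when `∂M ≠ ∅` (the integrand `-e^{2x} dx` is a smooth top form on a compact manifold,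
so `MForm.integral`, the `finsum` of chart integrals against the chosen partition of unity, is
its genuine integral); on a non-compact `M` the value of `MForm.integral` carries no information
(cf. the module docstrings of `L2HodgeTheoryLaplacianProofs.lean` and
`L2HodgeTheoryHarmonicExactProofs.lean` for the sibling facts). Following the provefact protocol
(a mis-stated named fact is corrected under a new name, never edited in place), the closed
corrected statement is `l2Inner_hodgeLaplacian_self_nonneg_of_isClosedManifold` (discharged
here), the usable theorem is `l2Inner_hodgeLaplacian_self_nonneg_of_isSmoothForm`, and under
the intended instances the original `Prop` also holds
(`l2Inner_hodgeLaplacian_self_nonneg_of_compactSpace`).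

## Proof (as printed, Warner p. 221)

`Δ = dδ + δd` (`hodgeLaplacian`, by cases on the degree pair `(k, m)`, `k + m = n`). In the
generic pattern `⟨Δα, α⟩ = ⟨δα, δα⟩ + ⟨dα, dα⟩` is `l2Inner_hodgeLaplacian_left_eq` (additivity
of `∫_M` and Prop. 6.2 twice); on functions `Δ = δd` and `⟨δdα, α⟩ = ⟨dα, dα⟩`, in top degree
`Δ = dδ` and `⟨dδα, α⟩ = ⟨δα, δα⟩` (Prop. 6.2 once, `MForm.l2Inner_mextDeriv_left_of_isSmoothForm`:
the wedge identity `∫_M dβ ∧ ⋆γ = ∫_M β ∧ ⋆δγ`, `integral_mextDeriv_wedge_hodgeStar`, i.e.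
Stokes, read through `β ∧ ⋆γ = ⟪β, γ⟫ vol`, `MForm.wedge_hodgeStar`), and for `(k, m) = (0, 0)`
(`n = 0`) `Δ = 0`.
Each energy `⟨γ, γ⟩ = ∫_M ⟪γ, γ⟫ vol` is `≥ 0` (`MForm.l2Inner_self_nonneg`, fed the discharged
positivity `integral_smul_riemannianVolumeForm_nonneg_holds`, Lee (2013), Prop. 16.6 (c)).

## References

* F. W. Warner, *Foundations of Differentiable Manifolds and Lie Groups*, GTM 94, Springer
  (1983): 6.1 (5) (p. 220), Prop. 6.2 (pp. 220–221), Prop. 6.3, proof, eq. (1) (p. 221).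
* J. Jost, *Riemannian Geometry and Geometric Analysis*, §3.3, Cor. 3.3.1.

## Verdict clean-up note (2026-08-15)

The named fact `l2Inner_hodgeLaplacian_self_nonneg` is now an `@[deprecated]` record of
`L2HodgeTheory.lean` (mis-stated, resp. refuted as stated: a `def` does not abstract the unused
section instances it was written under; the corrected statements are the ones proved or named in
this file and in the records' docstrings). The declaration
`l2Inner_hodgeLaplacian_self_nonneg_of_compactSpace` names the record on purpose, so
`linter.deprecated` is silenced on exactly that declaration (REMOVE-WHEN the records are deleted
from `L2HodgeTheory.lean`).
-/

noncomputable section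

open scoped Manifold ContDiff Topology
open Bundle Module
open Literature.Geometry.Kaehler
open Literature.Geometry.Kaehler.MForm

namespace Literature.NumberTheory.Transcendental

/-! ### The energy identity in the degenerate degree patterns -/

section Closed

variable {E : Type*} [NormedAddCommGroup E] [NormedSpace ℝ E] [FiniteDimensional ℝ E]
  {n : ℕ} [Fact (finrank ℝ E = n)] [MeasurableSpace E] [BorelSpace E]
  {H : Type*} [TopologicalSpace H] {I : ModelWithCorners ℝ E H}
  {M : Type*} [TopologicalSpace M] [ChartedSpace H M] [T2Space M] [CompactSpace M]
  [I.Boundaryless] [IsManifold I ∞ M] [RiemannianBundle (fun x : M ↦ TangentSpace I x)]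
  [IsContinuousRiemannianBundle E (fun x : M ↦ TangentSpace I x)]
  [IsContMDiffRiemannianBundle I ∞ E (fun x : M ↦ TangentSpace I x)]
  (o : (x : M) → Orientation ℝ (TangentSpace I x) (Fin n)) {k m : ℕ}

/-- Warner's 6.3 (1), polarised, in degree `0` (`0 + (m + 1) = n`): on functions `Δ = δd`
(there is no `Ω⁻¹`), so `⟪Δα, β⟫ = ⟪δdα, β⟫ = ⟪β, δdα⟫ = ⟪dβ, dα⟫ = ⟪dα, dβ⟫` for smooth
`0`-forms on a compact oriented Riemannian manifold without boundary (Prop. 6.2 and the symmetry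
of `⟪·, ·⟫`). Warner (1983), proof of Prop. 6.3, eq. (1), p. 221.
[cite: WarnerGTM94, Prop. 6.3 (1), p. 221] -/
theorem l2Inner_hodgeLaplacian_eq_of_degree_zero (ho : IsSmoothForm (riemannianVolumeForm o))
    (h : 0 + (m + 1) = n) {α β : MForm I M ℝ 0} (hα : IsSmoothForm α) (hβ : IsSmoothForm β) :
    l2Inner o (hodgeLaplacian o 0 (m + 1) h α) β = l2Inner o (mextDeriv α) (mextDeriv β) := by
  have h1 : (0 + 1) + m = n := by omega
  have hdα : IsSmoothForm (mextDeriv α) := isSmoothForm_mextDeriv (inChart_mextDeriv_holds I M ℝ) hα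
  have hΔ : hodgeLaplacian o 0 (m + 1) h α = mcoderiv o h1 (mextDeriv α) := rfl
  rw [hΔ, MForm.l2Inner_symm o _ β, ← MForm.l2Inner_mextDeriv_left_of_isSmoothForm o ho h1 hβ hdα,
    MForm.l2Inner_symm o (mextDeriv β) (mextDeriv α)]

/-- Warner's 6.3 (1), polarised, in top degree (`(k + 1) + 0 = n`): `Δ = dδ` (the `δd` term
lives in `Ω^{n+1} = 0`), so `⟪Δα, β⟫ = ⟪dδα, β⟫ = ⟪δα, δβ⟫` for smooth top forms on a compact
oriented Riemannian manifold without boundary (Prop. 6.2). Warner (1983), proof of Prop. 6.3,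
eq. (1), p. 221. [cite: WarnerGTM94, Prop. 6.3 (1), p. 221] -/
theorem l2Inner_hodgeLaplacian_eq_of_top_degree (ho : IsSmoothForm (riemannianVolumeForm o))
    (h : (k + 1) + 0 = n) {α β : MForm I M ℝ (k + 1)} (hα : IsSmoothForm α)
    (hβ : IsSmoothForm β) :
    l2Inner o (hodgeLaplacian o (k + 1) 0 h α) β = l2Inner o (mcoderiv o h α) (mcoderiv o h β) := by
  have hΔ : hodgeLaplacian o (k + 1) 0 h α = mextDeriv (mcoderiv o h α) := rfl
  rw [hΔ]
  exact MForm.l2Inner_mextDeriv_left_of_isSmoothForm o ho h (IsSmoothForm.mcoderiv o ho h hα) hβ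

/-! ### `0 ≤ ⟪Δα, α⟫` -/

/-- **The Hodge Laplacian is nonnegative in `L²`**: `0 ≤ ⟪Δα, α⟫` for a smooth `k`-form `α` on a
compact oriented Riemannian manifold without boundary (Hausdorff `C^∞` manifold, `C^∞` metric,
`vol_o` smooth; `k + m = n`), since `⟪Δα, α⟫ = ‖δα‖² + ‖dα‖²` (Warner (1983), proof of
Prop. 6.3, eq. (1), p. 221: `l2Inner_hodgeLaplacian_left_eq` in the generic degree pattern,
`l2Inner_hodgeLaplacian_eq_of_degree_zero` / `_of_top_degree` in the degenerate ones, `Δ = 0`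
for `n = 0`) and every energy `⟪γ, γ⟫ = ∫_M ⟪γ, γ⟫ vol` is `≥ 0` (`MForm.l2Inner_self_nonneg`
with the discharged positivity `integral_smul_riemannianVolumeForm_nonneg_holds`). This is the
usable form of the (corrected) named fact `l2Inner_hodgeLaplacian_self_nonneg`; cf. Jost, §3.3,
Cor. 3.3.1. [cite: WarnerGTM94, Prop. 6.3 (1), p. 221] -/
theorem l2Inner_hodgeLaplacian_self_nonneg_of_isSmoothForm
    (ho : IsSmoothForm (riemannianVolumeForm o)) (h : k + m = n) {α : MForm I M ℝ k}
    (hα : IsSmoothForm α) : 0 ≤ l2Inner o (hodgeLaplacian o k m h α) α := by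
  have hpos : ∀ {j : ℕ} (γ : MForm I M ℝ j), 0 ≤ l2Inner o γ γ := fun γ ↦
    MForm.l2Inner_self_nonneg o (fun hf ↦ integral_smul_riemannianVolumeForm_nonneg_holds o hf) γ
  rcases k with - | k <;> rcases m with - | m
  · -- `n = 0`: `Δ = 0`
    have hΔ : hodgeLaplacian o 0 0 h α = 0 := rfl
    rw [hΔ, l2Inner_zero_left_eq]
  · rw [l2Inner_hodgeLaplacian_eq_of_degree_zero o ho h hα hα]
    exact hpos _
  · rw [l2Inner_hodgeLaplacian_eq_of_top_degree o ho h hα hα]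
    exact hpos _
  · rw [l2Inner_hodgeLaplacian_left_eq o ho h hα hα]
    exact add_nonneg (hpos _) (hpos _)

-- names the `@[deprecated]` record `l2Inner_hodgeLaplacian_self_nonneg` on purpose (verdict clean-up 2026-08-15); REMOVE-WHEN the
-- record is deleted from `L2HodgeTheory.lean`
set_option linter.deprecated false in
/-- **Bridge to the named fact as declared.** In the presence of the intended instances
(`CompactSpace M`, `I.Boundaryless`, continuous and `C^∞` metric — the variables of
`section Closed` of `L2HodgeTheory.lean` that the `def` does not abstract), the over-general
named fact `l2Inner_hodgeLaplacian_self_nonneg o` holds (its body quantifies `ho`, `h`, `α`, `hα`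
itself). Warner (1983), Prop. 6.3 (1), p. 221. [cite: WarnerGTM94, Prop. 6.3 (1), p. 221] -/
theorem l2Inner_hodgeLaplacian_self_nonneg_of_compactSpace :
    l2Inner_hodgeLaplacian_self_nonneg (k := k) (m := m) o :=
  fun ho h _ hα ↦ l2Inner_hodgeLaplacian_self_nonneg_of_isSmoothForm o ho h hα

end Closed

/-! ### The corrected named fact -/

section CorrectedFact

/-- **Nonnegativity of the Hodge Laplacian as a closed named fact, correctly stated.** On a
compact oriented Riemannian manifold without boundary — Hausdorff `C^∞` manifold, `C^∞` metric,
orientation family `o` with smooth volume form — every smooth `k`-form `α` (`k + m = n`)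
satisfies `0 ≤ ⟨Δα, α⟩`, because `⟨Δα, α⟩ = ⟨δα, δα⟩ + ⟨dα, dα⟩` (F. W. Warner, *Foundations of
Differentiable Manifolds and Lie Groups*, GTM 94 (1983), proof of Prop. 6.3, eq. (1), p. 221,
from Prop. 6.2; standing hypothesis p. 220: "`M` will be a compact oriented Riemannian manifold").
**Correction** of the named fact
`Literature.NumberTheory.Transcendental.l2Inner_hodgeLaplacian_self_nonneg` of
`L2HodgeTheory.lean` (whose docstring also mis-locates the result as "Prop. 6.2 (b)–(c)"): that
`def … : Prop` was written after
`variable [CompactSpace M] [I.Boundaryless] [IsContinuousRiemannianBundle E _]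
[IsContMDiffRiemannianBundle I ∞ E _]`, but a `def` does not abstract unused section instances,
so its elaborated statement binds only `[T2Space M] [SigmaCompactSpace M] [IsManifold I ∞ M]
[RiemannianBundle _]`: it quantifies over σ-compact manifolds possibly with boundary and over
metrics of no regularity. With boundary the statement fails — on `M = [0, 1]` (flat metric,
`α = eˣ` a `0`-form) `Δα = -α″` and `⟨Δα, α⟩ = -∫₀¹ e^{2x} dx < 0`, the printed identity
acquiring the boundary term `-[α α′]₀¹` — so the original cannot be discharged as declared. Here
all hypotheses are binders *of the statement*; it is discharged by
`l2Inner_hodgeLaplacian_self_nonneg_of_isClosedManifold_holds`, the usable form is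
`l2Inner_hodgeLaplacian_self_nonneg_of_isSmoothForm`, and under the intended instances the
original `Prop` holds too (`l2Inner_hodgeLaplacian_self_nonneg_of_compactSpace`).
[cite: WarnerGTM94, Prop. 6.3 (1), p. 221] -/
def l2Inner_hodgeLaplacian_self_nonneg_of_isClosedManifold : Prop :=
  ∀ {E : Type*} [NormedAddCommGroup E] [NormedSpace ℝ E] [FiniteDimensional ℝ E] {n : ℕ}
    [Fact (finrank ℝ E = n)] [MeasurableSpace E] [BorelSpace E]
    {H : Type*} [TopologicalSpace H] {I : ModelWithCorners ℝ E H}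
    {M : Type*} [TopologicalSpace M] [ChartedSpace H M] [T2Space M] [CompactSpace M]
    [I.Boundaryless] [IsManifold I ∞ M] [RiemannianBundle (fun x : M ↦ TangentSpace I x)]
    [IsContinuousRiemannianBundle E (fun x : M ↦ TangentSpace I x)]
    [IsContMDiffRiemannianBundle I ∞ E (fun x : M ↦ TangentSpace I x)] {k m : ℕ}
    (o : (x : M) → Orientation ℝ (TangentSpace I x) (Fin n)),
    IsSmoothForm (riemannianVolumeForm o) → ∀ (h : k + m = n) {α : MForm I M ℝ k},
      IsSmoothForm α → 0 ≤ MForm.l2Inner o (hodgeLaplacian o k m h α) α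

/-- **Discharge** of `l2Inner_hodgeLaplacian_self_nonneg_of_isClosedManifold` (the corrected form
of the named fact `l2Inner_hodgeLaplacian_self_nonneg`): immediate from
`l2Inner_hodgeLaplacian_self_nonneg_of_isSmoothForm`. Warner (1983), Prop. 6.3 (1), p. 221.
[cite: WarnerGTM94, Prop. 6.3 (1), p. 221] -/
theorem l2Inner_hodgeLaplacian_self_nonneg_of_isClosedManifold_holds :
    l2Inner_hodgeLaplacian_self_nonneg_of_isClosedManifold :=
  fun o ho h _ hα ↦ l2Inner_hodgeLaplacian_self_nonneg_of_isSmoothForm o ho h hα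

end CorrectedFact

end Literature.NumberTheory.Transcendental
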